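import Mathlib
import Summits.NavierStokesRegularity.NavierStokesRegularity.Theorems.EulerZoomLiouvillePowerGaugeEulerLiouvilleCondenserCircleMeanCapacity

/-!
# THE RADIAL DERIVATIVE OF A CIRCULAR MEAN AND THE POLAR SPLIT OF A PLANAR GRADIENT — tools for plate t46-G
«CondenserPythagoras» (nsreg-p2 g34/g35, ROUND-44 THEOREM G, `r44/Sketch44b.lean`)

Width piece for crux `EulerZoomLiouville.PowerGaugeEulerLiouville` (stmt-NavierStokesRegularity-19832), by name under
LEAD 19832 (ns-typeII-p2 g13); seat ns-sfl-p1 g6, `--supports stmt-NavierStokesRegularity-19832 --as helper`.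
Self-contained plane calculus (no flow, no profile):

* `hasDerivAt_circleAverage_radius` — for `φ ∈ C¹(ℂ,ℝ)` the circular mean `m(ρ) = ⨍_{‖z‖=ρ} φ`
  (`Real.circleAverage φ 0 ρ`) is differentiable in the radius with
  `m′(ρ) = (2π)⁻¹ ∫_0^{2π} Dφ(ρe^{iθ})[e^{iθ}] dθ` (differentiation under the integral sign), and this derivative is
  continuous (`continuous_circleAverage_radialDeriv`); `integral_circleAverage_radialDeriv` — `∫_w^r m′ = m(r) − m(w)`;
* `opNorm_sq_eq_sub_radial` — for a real-linear functional `L` on `ℂ`, a unit vector `u` and `c ∈ ℝ`: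
  `‖L‖² = ‖L − c⟪u,·⟫‖² + 2c·L u − c²` (Riesz representation `InnerProductSpace.toDual`);
* `hasFDerivAt_norm_complex`, `hasFDerivAt_radial` — `D‖·‖(z) = ⟪z/‖z‖, ·⟫` and the chain rule for `z ↦ m(‖z‖)`
  away from the origin.

HONEST FRAMING: plane calculus; proves nothing about the crux E (19832 OPEN), any door Target, or Navier–Stokes regularity;
no summit statement is touched. [folklore]
-/

noncomputable section

open Set Filter Topology Metric Function MeasureTheory intervalIntegral Complex
open scoped Real NNReal ENNReal Interval RealInnerProductSpace

set_option linter.dupNamespace false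

namespace Summit.NavierStokesRegularity.NavierStokesRegularity.Theorems.PowerGaugeEulerLiouville.Condenser

/-! ## §1 The radial derivative of the circular mean -/

/-- `d/dρ circleMap 0 ρ θ = circleMap 0 1 θ = e^{iθ}`. [folklore] -/
theorem hasDerivAt_circleMap_radius (θ ρ : ℝ) :
    HasDerivAt (fun ρ : ℝ => circleMap 0 ρ θ) (circleMap 0 1 θ) ρ := by
  have h : HasDerivAt (fun ρ : ℝ => (ρ : ℂ) * Complex.exp (θ * I)) (Complex.exp (θ * I)) ρ := by
    simpa using ((hasDerivAt_id ρ).ofReal_comp).mul_const (Complex.exp (θ * I))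
  have h1 : (fun ρ : ℝ => circleMap 0 ρ θ) = fun ρ : ℝ => (ρ : ℂ) * Complex.exp (θ * I) := by
    funext ρ; rw [circleMap_zero]
  rw [h1, circleMap_zero, Complex.ofReal_one, one_mul]
  exact h

/-- Radial derivative of `φ` along `ρ ↦ φ(ρ e^{iθ})`: `Dφ(ρe^{iθ})[e^{iθ}]`. [folklore] -/
theorem hasDerivAt_comp_circleMap_radius {φ : ℂ → ℝ} (hφ : Differentiable ℝ φ) (θ ρ : ℝ) :
    HasDerivAt (fun ρ : ℝ => φ (circleMap 0 ρ θ)) (fderiv ℝ φ (circleMap 0 ρ θ) (circleMap 0 1 θ)) ρ :=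
  (hφ _).hasFDerivAt.comp_hasDerivAt ρ (hasDerivAt_circleMap_radius θ ρ)

/-- The radial integrand `(ρ, θ) ↦ Dφ(ρe^{iθ})[e^{iθ}]` is jointly continuous for `φ ∈ C¹`. [folklore] -/
theorem continuous_radialIntegrand {φ : ℂ → ℝ} (hφ : ContDiff ℝ 1 φ) :
    Continuous (uncurry fun ρ θ : ℝ => fderiv ℝ φ (circleMap 0 ρ θ) (circleMap 0 1 θ)) := by
  have hcm : Continuous fun p : ℝ × ℝ => circleMap 0 p.1 p.2 := by unfold circleMap; fun_prop
  have hc1 : Continuous fun p : ℝ × ℝ => circleMap 0 1 p.2 := by unfold circleMap; fun_prop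
  exact ((hφ.continuous_fderiv one_ne_zero).comp hcm).clm_apply hc1

/-- **The circular mean is differentiable in the radius**, with derivative the mean of the radial derivative:
`d/dρ ⨍_{‖z‖=ρ} φ = (2π)⁻¹ ∫_0^{2π} Dφ(ρe^{iθ})[e^{iθ}] dθ` for `φ ∈ C¹(ℂ,ℝ)` (differentiation under the integral
sign, the radial derivative being bounded on compact sets). [folklore] -/
theorem hasDerivAt_circleAverage_radius {φ : ℂ → ℝ} (hφ : ContDiff ℝ 1 φ) (ρ₀ : ℝ) :
    HasDerivAt (fun ρ : ℝ => Real.circleAverage φ 0 ρ)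
      ((2 * π)⁻¹ * ∫ θ in (0 : ℝ)..2 * π, fderiv ℝ φ (circleMap 0 ρ₀ θ) (circleMap 0 1 θ)) ρ₀ := by
  have hφd : Differentiable ℝ φ := hφ.differentiable one_ne_zero
  have hφc : Continuous φ := hφ.continuous
  have hDc : Continuous (fderiv ℝ φ) := hφ.continuous_fderiv one_ne_zero
  have hI := continuous_radialIntegrand hφ
  -- a uniform bound for `‖Dφ‖` on the closed ball of radius `|ρ₀| + 1`
  obtain ⟨M, hM⟩ :=
    (isCompact_closedBall (0 : ℂ) (|ρ₀| + 1)).exists_bound_of_continuousOn hDc.continuousOn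
  have key := intervalIntegral.hasDerivAt_integral_of_dominated_loc_of_deriv_le
    (μ := volume) (a := 0) (b := 2 * π) (x₀ := ρ₀) (bound := fun _ => M)
    (F := fun ρ θ => φ (circleMap 0 ρ θ))
    (F' := fun ρ θ => fderiv ℝ φ (circleMap 0 ρ θ) (circleMap 0 1 θ))
    (ball_mem_nhds ρ₀ zero_lt_one)
    (Eventually.of_forall fun ρ =>
      (hφc.comp (continuous_circleMap 0 ρ)).aestronglyMeasurable)
    ((hφc.comp (continuous_circleMap 0 ρ₀)).intervalIntegrable _ _)
    ((hI.comp (continuous_const.prodMk continuous_id)).aestronglyMeasurable)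
    (Eventually.of_forall fun θ _ ρ hρ => by
      have hρ' : ‖circleMap 0 ρ θ‖ ≤ |ρ₀| + 1 := by
        rw [norm_circleMap_zero]
        have : |ρ - ρ₀| < 1 := by rw [← Real.dist_eq]; exact hρ
        have h2 := abs_sub_abs_le_abs_sub ρ ρ₀
        linarith
      calc ‖fderiv ℝ φ (circleMap 0 ρ θ) (circleMap 0 1 θ)‖
          ≤ ‖fderiv ℝ φ (circleMap 0 ρ θ)‖ * ‖circleMap 0 1 θ‖ := ContinuousLinearMap.le_opNorm _ _
        _ = ‖fderiv ℝ φ (circleMap 0 ρ θ)‖ := by rw [norm_circleMap_zero, abs_one, mul_one]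
        _ ≤ M := hM _ (mem_closedBall_zero_iff.2 hρ'))
    intervalIntegrable_const
    (Eventually.of_forall fun θ _ ρ _ => hasDerivAt_comp_circleMap_radius hφd θ ρ)
  have h2 := key.2.const_mul ((2 * π)⁻¹)
  have hfun : (fun ρ : ℝ => Real.circleAverage φ 0 ρ) =
      fun ρ : ℝ => (2 * π)⁻¹ * ∫ θ in (0 : ℝ)..2 * π, φ (circleMap 0 ρ θ) := by
    funext ρ; rw [Real.circleAverage_def, smul_eq_mul]
  rw [hfun]
  exact h2

/-- The radial derivative of the circular mean is continuous in the radius. [folklore] -/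
theorem continuous_circleAverage_radialDeriv {φ : ℂ → ℝ} (hφ : ContDiff ℝ 1 φ) :
    Continuous fun ρ : ℝ => (2 * π)⁻¹ * ∫ θ in (0 : ℝ)..2 * π, fderiv ℝ φ (circleMap 0 ρ θ) (circleMap 0 1 θ) :=
  continuous_const.mul
    (intervalIntegral.continuous_parametric_intervalIntegral_of_continuous' (continuous_radialIntegrand hφ) _ _)

/-- `deriv` form of `hasDerivAt_circleAverage_radius`. [folklore] -/
theorem deriv_circleAverage_radius {φ : ℂ → ℝ} (hφ : ContDiff ℝ 1 φ) (ρ : ℝ) :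
    deriv (fun ρ : ℝ => Real.circleAverage φ 0 ρ) ρ =
      (2 * π)⁻¹ * ∫ θ in (0 : ℝ)..2 * π, fderiv ℝ φ (circleMap 0 ρ θ) (circleMap 0 1 θ) :=
  (hasDerivAt_circleAverage_radius hφ ρ).deriv

/-- FTC for the circular mean: `∫_w^r m′ = m(r) − m(w)`. [folklore] -/
theorem integral_circleAverage_radialDeriv {φ : ℂ → ℝ} (hφ : ContDiff ℝ 1 φ) (w r : ℝ) :
    ∫ ρ in w..r, (2 * π)⁻¹ * ∫ θ in (0 : ℝ)..2 * π, fderiv ℝ φ (circleMap 0 ρ θ) (circleMap 0 1 θ) =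
      Real.circleAverage φ 0 r - Real.circleAverage φ 0 w :=
  integral_eq_sub_of_hasDerivAt (fun ρ _ => hasDerivAt_circleAverage_radius hφ ρ)
    ((continuous_circleAverage_radialDeriv hφ).intervalIntegrable _ _)

/-! ## §2 The polar split of a planar gradient -/

/-- The Riesz map sends `u` to the functional `⟪u, ·⟫`. [folklore] -/
theorem toDual_eq_innerSL (u : ℂ) : InnerProductSpace.toDual ℝ ℂ u = innerSL ℝ u := by
  ext w
  rw [InnerProductSpace.toDual_apply_apply, innerSL_apply_apply]

/-- **Polar split of a planar gradient.**  For a real-linear functional `L` on `ℂ`, a unit vector `u` and `c ∈ ℝ`: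
`‖L‖² = ‖L − c⟪u, ·⟫‖² + 2c · L u − c²` — with `L = Dφ(z)`, `u = z/‖z‖`, `c = m′(‖z‖)` this is
`‖Dφ‖² = ‖D(φ − m∘‖·‖)‖² + 2m′∂_ρφ − m′²`. [folklore] -/
theorem opNorm_sq_eq_sub_radial (L : ℂ →L[ℝ] ℝ) {u : ℂ} (hu : ‖u‖ = 1) (c : ℝ) :
    ‖L‖ ^ 2 = ‖L - c • innerSL ℝ u‖ ^ 2 + 2 * c * L u - c ^ 2 := by
  set v : ℂ := (InnerProductSpace.toDual ℝ ℂ).symm L with hv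
  have hL : InnerProductSpace.toDual ℝ ℂ v = L := by rw [hv, LinearIsometryEquiv.apply_symm_apply]
  have hnormL : ‖L‖ = ‖v‖ := by rw [← hL, LinearIsometryEquiv.norm_map]
  have hsub : L - c • innerSL ℝ u = InnerProductSpace.toDual ℝ ℂ (v - c • u) := by
    rw [map_sub, map_smul, hL, toDual_eq_innerSL]
  have hnorm2 : ‖L - c • innerSL ℝ u‖ = ‖v - c • u‖ := by rw [hsub, LinearIsometryEquiv.norm_map]
  have hLu : L u = ⟪v, u⟫ := by rw [hv, InnerProductSpace.toDual_symm_apply]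
  rw [hnormL, hnorm2, hLu, norm_sub_sq_real, real_inner_smul_right, norm_smul, Real.norm_eq_abs, hu, mul_one,
    sq_abs]
  ring

/-! ## §3 Radial functions away from the origin -/

/-- Derivative of the norm on `ℂ ∖ {0}`: `D‖·‖(z) = ‖z‖⁻¹ ⟪z, ·⟫`. [folklore] -/
theorem hasFDerivAt_norm_complex {z : ℂ} (hz : z ≠ 0) :
    HasFDerivAt (fun w : ℂ => ‖w‖) (‖z‖⁻¹ • innerSL ℝ z) z := by
  have h1 : HasFDerivAt (fun w : ℂ => ‖w‖ ^ 2) (2 • innerSL ℝ z) z := (hasStrictFDerivAt_norm_sq z).hasFDerivAt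
  have hz2 : ‖z‖ ^ 2 ≠ 0 := pow_ne_zero 2 (norm_ne_zero_iff.2 hz)
  have h2 := h1.sqrt hz2
  have hfun : (fun w : ℂ => Real.sqrt (‖w‖ ^ 2)) = fun w : ℂ => ‖w‖ := by
    funext w; rw [Real.sqrt_sq (norm_nonneg _)]
  rw [hfun, Real.sqrt_sq (norm_nonneg _)] at h2
  have hcoef : (1 / (2 * ‖z‖)) • ((2 : ℕ) • innerSL ℝ z) = ‖z‖⁻¹ • innerSL ℝ z := by
    rw [two_nsmul, ← two_smul ℝ (innerSL ℝ z), smul_smul]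
    congr 1
    field_simp
  rw [← hcoef]
  exact h2

/-- Chain rule for a radial function away from the origin: if `HasDerivAt m m₁ ‖z‖` then
`D(m∘‖·‖)(z) = m₁ ‖z‖⁻¹ ⟪z, ·⟫`. [folklore] -/
theorem hasFDerivAt_radial {m : ℝ → ℝ} {m₁ : ℝ} {z : ℂ} (hz : z ≠ 0) (hm : HasDerivAt m m₁ ‖z‖) :
    HasFDerivAt (fun w : ℂ => m ‖w‖) (m₁ • (‖z‖⁻¹ • innerSL ℝ z)) z :=
  hm.comp_hasFDerivAt z (hasFDerivAt_norm_complex hz)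

/-- Homogeneity of the Riesz functional: `‖z‖⁻¹ ⟪z, ·⟫ = ⟪‖z‖⁻¹ z, ·⟫`. [folklore] -/
theorem inv_norm_smul_innerSL (z : ℂ) : ‖z‖⁻¹ • innerSL ℝ z = innerSL ℝ ((‖z‖⁻¹ : ℝ) • z) := by
  ext w
  simp only [FunLike.coe_smul, Pi.smul_apply, innerSL_apply_apply, real_inner_smul_left, smul_eq_mul]

/-- **Derivative of `φ − m∘‖·‖` away from the origin.**  If `HasDerivAt m m₁ ‖z‖`, `z ≠ 0`, then
`D(φ − m∘‖·‖)(z) = Dφ(z) − m₁ ⟪z/‖z‖, ·⟫`. [folklore] -/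
theorem fderiv_sub_radial {φ : ℂ → ℝ} (hφ : Differentiable ℝ φ) {m : ℝ → ℝ} {m₁ : ℝ} {z : ℂ} (hz : z ≠ 0)
    (hm : HasDerivAt m m₁ ‖z‖) :
    fderiv ℝ (fun w : ℂ => φ w - m ‖w‖) z = fderiv ℝ φ z - m₁ • innerSL ℝ ((‖z‖⁻¹ : ℝ) • z) := by
  have h : HasFDerivAt (fun w : ℂ => φ w - m ‖w‖) (fderiv ℝ φ z - m₁ • (‖z‖⁻¹ • innerSL ℝ z)) z :=
    ((hφ z).hasFDerivAt).sub (hasFDerivAt_radial hz hm)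
  rw [h.fderiv, inv_norm_smul_innerSL]

end Summit.NavierStokesRegularity.NavierStokesRegularity.Theorems.PowerGaugeEulerLiouville.Condenser

end
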